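import Summits.RiemannHypothesis.RiemannHypothesis.Theorems.HandoffLatticeNyman
import HarnessLib

/-!
# THEOREM N(b), part 2/2 — small lattice tails on ONE fibre force RH (the fibre form of Nyman–Beurling)

Handoff track (ROUTE 1′), prove-1 gen14, ATTEMPT-21 §8; concludes `HandoffLatticeNyman` (part 1/2:
the fibre test functions `fibreFn c b = 1_{(0,1]} - 1_{(0,1/2]} + Σ_j c_j 1_{(0,b_j]}`, their Beurling
form `θ_f(u) = -({1/u} - {1/(2u)} + Σ c_j{b_j/u})` on a mass-zero fibre, and Nyman's integrals
`∫_0^{1/2} {b/u} u^{s-1} du`). THEOREM (`riemannHypothesis_of_latticeTail_fibre`): if the window datum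
`1_{(1/2,1]}` over `[1/2, 2]` admits inner step completions (`0 < b_j ≤ 1/2`, `Σ c_j b_j = -1/2`) of
arbitrarily small `latticeTail 2`, then `RiemannHypothesis`. Proof: an off-critical zero `s`,
`1/2 < Re s < 1` (the only case left by `quasiRiemannHypothesis_one_half_iff_holds`), pairs with `θ_f`
through `u^{s-1} ∈ L²(0,1/2)` to the FIBRE-CONSTANT value `(2^{-s} - 1)/s ≠ 0` (Nyman's formula; the
mass condition cancels the inner pieces), and Cauchy–Schwarz bounds `latticeTail 2 f` below by
`‖(2^{-s}-1)/s‖² (2Re s - 1) 2^{2Re s - 1}` on the whole fibre. The converse (RH ⟹ such completions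
exist) is Báez-Duarte's theorem (tree `baezDuarte_iff_holds`) + Beurling's dilation step (ATTEMPT-21
§8.2, paper). The EASY half of Nyman–Beurling in idea-1's coordinates; nothing here is evidence for RH.
-/

set_option linter.dupNamespace false

noncomputable section

open Complex MeasureTheory Set Filter Finset
open scoped Real FourierTransform

namespace Summit.RiemannHypothesis.RiemannHypothesis.Theorems

namespace LatticeUncertainty

open Literature.NumberTheory.LFunctions

/-- ★ **THEOREM N(b) (ATTEMPT-21 §8): the fibre form of Nyman–Beurling, RH-yielding half.** If the
window datum `1_{(1/2,1]}` over the window `[1/2, 2]` admits inner step completions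
`Σ_j c_j 1_{(0,b_j]}` (`0 < b_j ≤ 1/2`, mass `Σ c_j b_j = -1/2`) of arbitrarily small lattice tail
`latticeTail 2 f = ∫_0^{1/2} |Σ_n f(nu)|² du`, then the Riemann hypothesis holds. (Contrapositive of:
an off-critical zero `ρ₀`, `Re ρ₀ > 1/2`, forces `latticeTail 2 f ≥ |(1-2^{-ρ₀})/ρ₀|²(2Re ρ₀-1)2^{2Re ρ₀-1}`
on the whole fibre.) The converse implication is Báez-Duarte's theorem + Beurling's dilation step
(ATTEMPT-21 §8.2). Nothing here is evidence for RH. [cite: BaezDuarte2003, Thm. 1.1 (method of the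
"if" part)] -/
theorem riemannHypothesis_of_latticeTail_fibre
    (h : ∀ ε : ℝ, 0 < ε → ∃ (n : ℕ) (c : Fin n → ℂ) (b : Fin n → ℝ),
      (∀ j, 0 < b j ∧ b j ≤ 1 / 2) ∧ (∑ j, c j * (b j : ℂ) = -(1 / 2 : ℂ)) ∧
        latticeTail 2 (fibreFn c b) < ε) :
    RiemannHypothesis := by
  refine quasiRiemannHypothesis_one_half_iff_holds.1 fun s hζ hσ hσ1 ↦ ?_
  set σ : ℝ := s.re with hσdef
  have hre0 : 0 < σ := by linarith
  have hs0 : s ≠ 0 := fun h' ↦ by rw [h', Complex.zero_re] at hσdef; linarith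
  have hs1 : s ≠ 1 := fun h' ↦ by rw [h', Complex.one_re] at hσdef; linarith
  -- the constants: `G = ∫_0^{1/2} u^{2σ-2}` and the value `v = (2^{-s}-1)/s ≠ 0`
  set G : ℝ := (1 / 2 : ℝ) ^ (2 * σ - 1) / (2 * σ - 1) with hG
  have h2σ : 0 < 2 * σ - 1 := by linarith
  have hG0 : 0 < G := div_pos (Real.rpow_pos_of_pos (by norm_num) _) h2σ
  set v : ℂ := ((2 : ℂ) ^ (-s) - 1) / s with hv
  have hv0 : v ≠ 0 := by
    rw [hv]
    refine div_ne_zero (sub_ne_zero.2 fun h' ↦ ?_) hs0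
    have : ‖(2 : ℂ) ^ (-s)‖ = 1 := by rw [h', norm_one]
    rw [show (2 : ℂ) = ((2 : ℝ) : ℂ) by norm_num, Complex.norm_cpow_eq_rpow_re_of_pos two_pos,
      neg_re] at this
    have hlt : (2 : ℝ) ^ (-σ) < 1 := Real.rpow_lt_one_of_one_lt_of_neg (by norm_num) (by linarith)
    linarith
  have hvpos : 0 < ‖v‖ ^ 2 / G := div_pos (pow_pos (norm_pos_iff.2 hv0) 2) hG0
  obtain ⟨n, c, b, hb, hmass, hT⟩ := h (‖v‖ ^ 2 / G) hvpos
  -- the Beurling form `φ` of the dilation sum and its bound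
  set φ : ℝ → ℂ := fun u ↦ -(((Int.fract (1 / u) : ℝ) : ℂ) - ((Int.fract ((1 / 2) / u) : ℝ) : ℂ)
      + ∑ j, c j * ((Int.fract (b j / u) : ℝ) : ℂ)) with hφ
  have hφm : Measurable φ := by
    refine Measurable.neg (Measurable.add (Measurable.sub ?_ ?_) (Finset.measurable_sum _ fun j _ ↦ ?_))
    · exact Complex.measurable_ofReal.comp (measurable_fract.comp (measurable_const.div measurable_id))
    · exact Complex.measurable_ofReal.comp (measurable_fract.comp (measurable_const.div measurable_id))
    · exact measurable_const.mul
        (Complex.measurable_ofReal.comp (measurable_fract.comp (measurable_const.div measurable_id)))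
  have hθφ : ∀ u ∈ Set.Ioc (0 : ℝ) (1 / 2), dilationSum 2 (fibreFn c b) u = φ u :=
    fun u hu ↦ dilationSum_fibreFn_eq c b hb hmass hu.1
  set B : ℝ := 2 + ∑ j, ‖c j‖ with hB
  have hφB : ∀ u ∈ Set.Ioc (0 : ℝ) (1 / 2), ‖φ u‖ ≤ B := fun u hu ↦ by
    rw [← hθφ u hu]; exact norm_dilationSum_fibreFn_le c b hb hmass hu.1
  -- the lattice tail is `∫ ‖φ‖²`
  have hTφ : latticeTail 2 (fibreFn c b) = ∫ u in Set.Ioc (0 : ℝ) (1 / 2), ‖φ u‖ ^ 2 := by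
    unfold latticeTail
    rw [show (1 : ℝ) / 2 = 1 / 2 from rfl]
    exact setIntegral_congr_fun measurableSet_Ioc fun u hu ↦ by rw [hθφ u hu]
  -- the pairing `I = ∫ φ u^{s-1}`
  haveI : IsFiniteMeasure (volume.restrict (Set.Ioc (0 : ℝ) (1 / 2))) := by infer_instance
  have hpowI : IntegrableOn (fun u : ℝ ↦ (u : ℂ) ^ (s - 1)) (Set.Ioc (0 : ℝ) (1 / 2)) := by
    have := (intervalIntegral.intervalIntegrable_cpow' (a := 0) (b := 1 / 2) (r := s - 1)
      (by rw [sub_re, one_re]; linarith)).1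
    simpa using this
  have hfrI : ∀ b' : ℝ, Integrable (fun u : ℝ ↦ ((Int.fract (b' / u) : ℝ) : ℂ) * (u : ℂ) ^ (s - 1))
      (volume.restrict (Set.Ioc (0 : ℝ) (1 / 2))) := by
    intro b'
    refine Integrable.bdd_mul (c := 1) hpowI ?_ (Eventually.of_forall fun u ↦ ?_)
    · exact (Complex.measurable_ofReal.comp
        (measurable_fract.comp (measurable_const.div measurable_id))).aestronglyMeasurable
    · rw [Complex.norm_real, Real.norm_eq_abs, abs_of_nonneg (Int.fract_nonneg _)]
      exact (Int.fract_lt_one _).le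
  have i1 : Integrable (fun u : ℝ ↦ ((Int.fract (1 / u) : ℝ) : ℂ) * (u : ℂ) ^ (s - 1)
      - ((Int.fract ((1 / 2) / u) : ℝ) : ℂ) * (u : ℂ) ^ (s - 1))
      (volume.restrict (Set.Ioc (0 : ℝ) (1 / 2))) := (hfrI 1).sub (hfrI (1 / 2))
  have i2 : Integrable (fun u : ℝ ↦ ∑ j, c j * (((Int.fract (b j / u) : ℝ) : ℂ) * (u : ℂ) ^ (s - 1)))
      (volume.restrict (Set.Ioc (0 : ℝ) (1 / 2))) :=
    integrable_finsetSum _ fun j _ ↦ (hfrI (b j)).const_mul (c j)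
  have hI : ∫ u in Set.Ioc (0 : ℝ) (1 / 2), φ u * (u : ℂ) ^ (s - 1)
      = -(nymanInt 1 s - nymanInt (1 / 2) s + ∑ j, c j * nymanInt (b j) s) := by
    have hlin : (fun u : ℝ ↦ φ u * (u : ℂ) ^ (s - 1)) = fun u ↦
        -((((Int.fract (1 / u) : ℝ) : ℂ) * (u : ℂ) ^ (s - 1)
          - ((Int.fract ((1 / 2) / u) : ℝ) : ℂ) * (u : ℂ) ^ (s - 1))
          + ∑ j, c j * (((Int.fract (b j / u) : ℝ) : ℂ) * (u : ℂ) ^ (s - 1))) := by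
      funext u; simp only [hφ, neg_mul, add_mul, sub_mul, Finset.sum_mul, mul_assoc]
    rw [hlin, integral_neg, integral_add i1 i2, integral_sub (hfrI 1) (hfrI (1 / 2)),
      integral_finsetSum _ fun j _ ↦ (hfrI (b j)).const_mul (c j)]
    simp only [integral_const_mul]
    rfl
  -- CLAIM A: the pairing is the fibre-constant `v = (2^{-s}-1)/s`
  obtain ⟨hh1, hh2⟩ := half_cpow s
  have hA : ∫ u in Set.Ioc (0 : ℝ) (1 / 2), φ u * (u : ℂ) ^ (s - 1) = v := by
    rw [hI, nymanInt_one hσ hs1, nymanInt_small (by norm_num) le_rfl hre0 hs1,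
      Finset.sum_congr rfl fun j _ ↦ by rw [nymanInt_small (hb j).1 (hb j).2 hre0 hs1],
      hζ]
    simp only [mul_zero, zero_div, sub_zero]
    have hsum : ∑ j, c j * ((2 : ℂ) ^ (-s) * (1 / ((((1 / (2 * b j) : ℝ)) : ℂ) * (s - 1))))
        = (2 : ℂ) ^ (-s) * 2 / (s - 1) * ∑ j, c j * (b j : ℂ) := by
      rw [Finset.mul_sum]
      refine Finset.sum_congr rfl fun j _ ↦ ?_
      have hbj : (b j : ℂ) ≠ 0 := by exact_mod_cast (hb j).1.ne'
      have hsm : s - 1 ≠ 0 := sub_ne_zero.2 hs1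
      push_cast
      field_simp
    rw [hsum, hmass, hh1, hh2, hv]
    have hsm : s - 1 ≠ 0 := sub_ne_zero.2 hs1
    push_cast
    field_simp
    ring
  -- CLAIM B: Cauchy–Schwarz `‖I‖² ≤ latticeTail · G`
  have hBφ : MemLp (fun u ↦ ‖φ u‖) (ENNReal.ofReal 2) (volume.restrict (Set.Ioc (0 : ℝ) (1 / 2))) := by
    rw [show ENNReal.ofReal 2 = 2 by norm_num]
    refine MemLp.of_bound hφm.norm.aestronglyMeasurable B ?_
    exact (ae_restrict_iff' measurableSet_Ioc).2
      (Eventually.of_forall fun u hu ↦ by rw [Real.norm_eq_abs, abs_norm]; exact hφB u hu)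
  have hBg : MemLp (fun u : ℝ ↦ u ^ (σ - 1)) (ENNReal.ofReal 2)
      (volume.restrict (Set.Ioc (0 : ℝ) (1 / 2))) := by
    rw [show ENNReal.ofReal 2 = 2 by norm_num,
      memLp_two_iff_integrable_sq_norm (by fun_prop : Measurable fun u : ℝ ↦ u ^ (σ - 1)).aestronglyMeasurable]
    have hI2 : IntegrableOn (fun u : ℝ ↦ u ^ (2 * σ - 2)) (Set.Ioc (0 : ℝ) (1 / 2)) :=
      (intervalIntegral.intervalIntegrable_rpow' (a := 0) (b := 1 / 2) (by linarith)).1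
    refine (hI2.congr_fun (fun u hu ↦ ?_) measurableSet_Ioc)
    have hu0 : 0 < u := hu.1
    rw [Real.norm_eq_abs, abs_of_nonneg (by positivity), ← Real.rpow_natCast,
      ← Real.rpow_mul hu0.le]
    norm_num; ring_nf
  have hCS := integral_mul_le_Lp_mul_Lq_of_nonneg (μ := volume.restrict (Set.Ioc (0 : ℝ) (1 / 2)))
    Real.HolderConjugate.two_two (Eventually.of_forall fun u ↦ norm_nonneg (φ u))
    ((ae_restrict_iff' measurableSet_Ioc).2
      (Eventually.of_forall fun u hu ↦ by have := hu.1; positivity))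
    hBφ hBg
  -- `‖I‖ ≤ ∫ ‖φ‖ u^{σ-1}`
  have hnormI : ‖v‖ ≤ ∫ u in Set.Ioc (0 : ℝ) (1 / 2), ‖φ u‖ * u ^ (σ - 1) := by
    rw [← hA]
    refine (norm_integral_le_integral_norm _).trans (le_of_eq ?_)
    refine setIntegral_congr_fun measurableSet_Ioc fun u hu ↦ ?_
    rw [norm_mul, Complex.norm_cpow_eq_rpow_re_of_pos hu.1, sub_re, one_re]
  -- evaluate the two factors
  have hf2 : ∫ u in Set.Ioc (0 : ℝ) (1 / 2), ‖φ u‖ ^ (2 : ℝ) = latticeTail 2 (fibreFn c b) := by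
    rw [hTφ]; exact integral_congr_ae (Eventually.of_forall fun u ↦ by simp only [Real.rpow_two])
  have hg2 : ∫ u in Set.Ioc (0 : ℝ) (1 / 2), (u ^ (σ - 1)) ^ (2 : ℝ) = G := by
    have heq : Set.EqOn (fun u : ℝ ↦ (u ^ (σ - 1)) ^ (2 : ℝ)) (fun u ↦ u ^ (2 * σ - 2))
        (Set.Ioc (0 : ℝ) (1 / 2)) := fun u hu ↦ by
      change (u ^ (σ - 1)) ^ (2 : ℝ) = u ^ (2 * σ - 2)
      rw [← Real.rpow_mul hu.1.le]; ring_nf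
    rw [setIntegral_congr_fun measurableSet_Ioc heq, ← intervalIntegral.integral_of_le (by norm_num),
      integral_rpow (Or.inl (by linarith)), hG]
    rw [Real.zero_rpow (by linarith), sub_zero, show 2 * σ - 2 + 1 = 2 * σ - 1 by ring]
  rw [hf2, hg2] at hCS
  -- `‖v‖ ≤ T^{1/2} G^{1/2}` ⇒ `‖v‖² ≤ T G < (‖v‖²/G) G = ‖v‖²`
  have hTnn : 0 ≤ latticeTail 2 (fibreFn c b) := by
    rw [hTφ]; exact integral_nonneg fun u ↦ by positivity
  have hle : ‖v‖ ≤ (latticeTail 2 (fibreFn c b)) ^ (1 / (2 : ℝ)) * G ^ (1 / (2 : ℝ)) :=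
    hnormI.trans hCS
  have hsq : ‖v‖ ^ 2 ≤ latticeTail 2 (fibreFn c b) * G := by
    have h1 : 0 ≤ (latticeTail 2 (fibreFn c b)) ^ (1 / (2 : ℝ)) * G ^ (1 / (2 : ℝ)) := by positivity
    calc ‖v‖ ^ 2 ≤ ((latticeTail 2 (fibreFn c b)) ^ (1 / (2 : ℝ)) * G ^ (1 / (2 : ℝ))) ^ 2 :=
          pow_le_pow_left₀ (norm_nonneg _) hle 2
      _ = latticeTail 2 (fibreFn c b) * G := by
          rw [mul_pow, ← Real.rpow_natCast, ← Real.rpow_natCast, ← Real.rpow_mul hTnn,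
            ← Real.rpow_mul hG0.le]
          norm_num
  have hlt : latticeTail 2 (fibreFn c b) * G < ‖v‖ ^ 2 := by
    calc latticeTail 2 (fibreFn c b) * G < ‖v‖ ^ 2 / G * G := by gcongr
      _ = ‖v‖ ^ 2 := by field_simp
  linarith

/-! Axiom census (expected: `propext`, `Classical.choice`, `Quot.sound`). -/
#print axioms riemannHypothesis_of_latticeTail_fibre

end LatticeUncertainty

end Summit.RiemannHypothesis.RiemannHypothesis.Theorems
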